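import Summits.QuantumFields.BalabanUV.Beta.GAN24.BornBorderLineage
import Summits.QuantumFields.BalabanUV.Beta.GAN24.BornLambdaLettersPoly

/-!
# `BalabanUV.Beta.GAN24.BornBorderLetters` — binder row G-an2-4 / (CONV-C), CT-ROUTE, the row owner gan24-p1-g21's `gen21/BORNV-PLAN-v0.md` §1 «(V-1)», the
# V HALF of `hB`: **THE V-BORN REMAINDER IN UNITS = SOURCE + UNDRESSED LINEAGES + CONTACT TERMS, AND THE SOCKET `hB(cVH, 0) ⟸ hUv ∧ hCv`** (the born V-table's own
# locality `hX_v` is discharged; per-lineage geometric ∕ poly-geometric letters) — the V twin of `BornLambdaLineage` §4–§5 + `BornLambdaLetters` §2–§3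

NOT IN PRINT; OUR BOOKKEEPING (G-an2-4 formalisation swarm → CRUX TEAM (2), leaf prover `b2b-balaban-gan24-formalise-leaf-01`, gen 60; the row owner's OFFER (W14),
journal `CLAIMS.log` l.34552, «MINE» l.34668; names PROVISIONAL — the owner may rename / re-cut).  [folklore] bookkeeping over tree theorems BY NAME: PART 1b
`BornBorderLineage` (`unitS_bornV_eq_sum`, `unitStepMap_v_eq_two_push₃`, `exists_hX_v`), leaf-03's `SrecBornSector.transport_unitStepMap_succ_eq_push₃`, leaf-12's
`RespStepSemigroup.respStep_self`, `BornLambdaLetters.locStencil_sum_of_geometric`, leaf-03's `BornLambdaLettersPoly.locStencil_sum_of_polyGeometric`.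
0 `def`, 0 cited facts, 0 `def … : Prop`, 0 sorry.  HONEST FRAMING (cell contract, verbatim): «discharging `BetaPertH` makes Bałaban's UV stability UNCONDITIONAL — a
real constructive-QFT result; it is NOT the continuum limit and NOT the Clay problem.»  HONEST DEPENDENCY (verbatim): «continuum YM on T⁴ ⇐ BetaPertH ∧ nine spine
estimates (0/9 proved); BetaPertH ⇐ (D1) ∧ (D4) ∧ CAP+tail; G-an2-4 gates asym, D1 and NE2/3/4.»

## What (generic `d`; in-block root `ρ = toSite rr`, `rr ∈ box (d+1) Lc`; `V := cVH • vhSAt ρ`, `w := cE·Lc^{2(d+1)}`, `K̃_i := KStepUnit Lc i`,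
## `R_i := respStepBm ρ Lc (Lc^i) (Lc^(i+1))` (ONE DRESSED step), `R⁰_i := respStep (Lc^i) (Lc^(i+1))` (undressed), `B_{i+1,k} := respStep (Lc^(i+1)) (Lc^k)`)
* §1 [folklore] **THE IDENTITY-LEG PUSH**: `vertexW (respStep M M) S κ′ u′ = S κ′ u′` and `push₃ (respStep M M) (respStep M M) (respStep M M) S κ′ u′ = S κ′ u′` for an
  ff-valued entry (`respStep_self` three times) — the top lineage `i = k−1` of §3's undressed sum has the identity legs `B_{k,k}`.
* §2 **THE UNDRESSED ONE-STEP IMAGE** `X⁰_i := w • −(push₃ (−R⁰_i) (colM K̃_i Lc) R⁰_i (reslot inl inr V) + push₃ (rowMM K̃_i Lc) R⁰_i R⁰_i (reslot inr inl V))` — PART 1b's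
  `unitStepMap_v_eq_two_push₃` with `respStepBm ↦ respStep` (signs as in its LEAN statement: `w • −(fm + mf)`); the ONE-STEP TELESCOPE `X_i − X⁰_i` displayed channel by
  channel in the shape of leaf-02's `ContactBorderKernelCells.contact_border_fm_eq_cells` ∕ `_mf_eq_cells` (`unitStepMap_v_sub_undressed`).
* §3 **MEMBER `k` = SOURCE + UNDRESSED LINEAGES + CONTACT TERMS** (`unitS_bornV_eq_source_add_undressed_add_contact`):
  `unitS_k (bornSecAt Lc ρ cE cVH 0 k) = V + Σ_{i<k} U_{i,k} + Σ_{i<k} (D_{i,k} − U_{i,k})`, with the DRESSED lineage `D_{i,k} := transport unitStepMap (i+1) (k−1−i) X_i`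
  (the summand of PART 1b's `unitS_bornV_eq_sum`; `= w^{n+1} • push₃ T′³ X_i`, `T′ = legChain (respStepBmSeq ρ Lc) (i+1) n` when `k−1−i = n+1`, `= X_{k−1}` at the top:
  `dressed_v_succ` ∕ `dressed_v_top`) and the UNDRESSED lineage `U_{i,k} := w^{k−i} • push₃ B_{i+1,k}³ (−(push₃ (−R⁰_i) (colM K̃_i Lc) R⁰_i (reslot inl inr V) + push₃ (rowMM K̃_i Lc)
  R⁰_i R⁰_i (reslot inr inl V)))` — the owner's `U^V_{i,k}` (`legChain ↦ respStep (Lc^(i+1)) (Lc^k)`, `respStepBm ↦ respStep`); at the top `U_{k−1,k} = X⁰_{k−1}` (§1: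
  `undressed_v_top`).
* §4 **THE SOCKET** `exists_hBv_of_letters (cE cVH) (hUv) (hCv) : hB(cVH, 0)` — PART 1b's `exists_hX_v` discharges the source letter at the common rate; `hUv` ∕ `hCv` are
  uniform `LocStencil` letters for `Σ_{i<k} U_{i,k}` ∕ `Σ_{i<k} (D_{i,k} − U_{i,k})`; the per-lineage forms `exists_hUv_of_geometric`, `exists_hCv_of_geometric`,
  **`exists_hBv_of_geometric`** (constants `C·θ^{k−i}`, `θ < 1`) and **`exists_hBv_of_geometric_poly`** (contact letter with logs `C·(k−i)^p·θ^{k−i}`).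
CONSUMERS (owner's §5 ORDER): (V-U) `BornBorderLift` ∕ `BornBorderUndressedRow` prove `hUv` from road S3's rooted V rows (nest + semigroup `B_{i+1,k} ∘ R⁰_i =
respStep (Lc^i) (Lc^k)`); (V-C) proves `hCv` (top lineage = §2's one-step telescope; deeper lineages = `Push3LegTelescope` on `T′ − B` + the outer push of §2's telescope).
Discharges NO letter but `hX_v`; asserts NO shape of Bałaban's stencils; NO estimate; `hB(cVH,0)`, `hB`, hS0-comb OPEN; NEVER «G-an2-4 closed»; NOT D1, NOT BetaPertH,
NOT continuum, NOT Clay.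
-/

noncomputable section

open Finset
open scoped BigOperators
open Literature.MathematicalPhysics.QuantumFieldTheory
open Literature.MathematicalPhysics.QuantumFieldTheory.Balaban1983to89
open Literature.MathematicalPhysics.QuantumFieldTheory.Balaban1983to89.Beta
open ExpKernelCalculus (MKer)
open AffineAveraging (box toSite)
open OneStepResolventKernel (Fib LocStencil)
open StepJetData (locStencil_add locStencil_smul)
open BalabanStepJets (locStencil_mono)
open AveragingHessianKernels (ell)
open AveragingHessianKernelsRooted (vhSAt)
open BalabanCompositeJets (respStep)
open Summit.QuantumFields.BalabanUV.Beta.HessKerDressedUnits (unitS)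
open Summit.QuantumFields.BalabanUV.Beta.AxialDressingRooted (one_le_of_neZero)
open Summit.QuantumFields.BalabanUV.Beta.GAN24.CombesThomas (sfStep smStep KStepUnit)
open Summit.QuantumFields.BalabanUV.Beta.GAN24.StencilSlotOfShapes (locStencil_mono')
open Summit.QuantumFields.BalabanUV.Beta.GAN24.Push4 (IsFF vertexW vertexW_apply)
open Summit.QuantumFields.BalabanUV.Beta.GAN24.Push4Iter (legChain)
open Summit.QuantumFields.BalabanUV.Beta.GAN24.Push3 (push₃ push₃_inl_inl push₃_inr_left push₃_inr_right isFF_push₃ push₃_smul)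
open Summit.QuantumFields.BalabanUV.Beta.GAN24.AffineUnroll (transport transport_zero)
open Summit.QuantumFields.BalabanUV.Beta.GAN24.RespStepSemigroup (respStep_self)
open Summit.QuantumFields.BalabanUV.Beta.GAN24.RespStepBmDecompExact (respStepBmSeq)
open Summit.QuantumFields.BalabanUV.Beta.GAN24.RespStepBm (respStepBm)
open Summit.QuantumFields.BalabanUV.Beta.GAN24.SrecLinearPartEq (colM rowMM reslot)
open Summit.QuantumFields.BalabanUV.Beta.GAN24.SrecWilsonSector (bornSecAt isFF_smul)
open Summit.QuantumFields.BalabanUV.Beta.GAN24.SrecBornSector (freshAt unitStepMap transport_unitStepMap_succ_eq_push₃)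
open Summit.QuantumFields.BalabanUV.Beta.GAN24.BornBorderLineage (unitS_bornV_eq_sum unitStepMap_v_eq_two_push₃ isFF_add isFF_neg isFF_unitStepMap_v
  isLoc_unitStepMap_v exists_hX_v)
open Summit.QuantumFields.BalabanUV.Beta.GAN24.BornLambdaLetters (locStencil_sum_of_geometric)
open Summit.QuantumFields.BalabanUV.Beta.GAN24.BornLambdaLettersPoly (locStencil_sum_of_polyGeometric)

namespace Summit.QuantumFields.BalabanUV.Beta.GAN24.BornBorderLetters

variable {d : ℕ}

/-! ## §1 The identity-leg push -/

/-- [folklore] The Kronecker collapse `Σ'_x Σ_κ [x = x′ ∧ κ = α]·f x κ = f x′ α`. -/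
theorem tsum_sum_ite_mul (f : (Fin (d + 1) → ℤ) → Fin (d + 1) → ℝ) (x' : Fin (d + 1) → ℤ) (α : Fin (d + 1)) :
    ∑' x : Fin (d + 1) → ℤ, ∑ κ : Fin (d + 1), (if x = x' ∧ κ = α then (1 : ℝ) else 0) * f x κ = f x' α := by
  rw [tsum_eq_single x' (fun x hx => Finset.sum_eq_zero fun κ _ => by rw [if_neg (fun h => hx h.1), zero_mul])]
  rw [Finset.sum_eq_single_of_mem α (Finset.mem_univ α) (fun κ _ hκ => by rw [if_neg (fun h => hκ h.2), zero_mul]), if_pos ⟨rfl, rfl⟩, one_mul]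

/-- [folklore] The Kronecker collapse `Σ'_z Σ_κ f z κ·[z = z′ ∧ κ = β] = f z′ β`. -/
theorem tsum_sum_mul_ite (f : (Fin (d + 1) → ℤ) → Fin (d + 1) → ℝ) (z' : Fin (d + 1) → ℤ) (β : Fin (d + 1)) :
    ∑' z : Fin (d + 1) → ℤ, ∑ κ : Fin (d + 1), f z κ * (if z = z' ∧ κ = β then (1 : ℝ) else 0) = f z' β := by
  simp only [mul_comm (f _ _)]
  exact tsum_sum_ite_mul f z' β

/-- [folklore] The Kronecker collapse `Σ_κ Σ'_u [u = u′ ∧ κ = κ′]·f κ u = f κ′ u′` (the `vertexW` order of summation). -/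
theorem sum_tsum_ite_mul (f : Fin (d + 1) → (Fin (d + 1) → ℤ) → ℝ) (κ' : Fin (d + 1)) (u' : Fin (d + 1) → ℤ) :
    ∑ κ : Fin (d + 1), ∑' u : Fin (d + 1) → ℤ, (if u = u' ∧ κ = κ' then (1 : ℝ) else 0) * f κ u = f κ' u' := by
  rw [Finset.sum_eq_single_of_mem κ' (Finset.mem_univ κ') (fun κ _ hκ => ?_)]
  · rw [tsum_eq_single u' (fun u hu => by rw [if_neg (fun h => hu h.1), zero_mul]), if_pos ⟨rfl, rfl⟩, one_mul]
  · exact (tsum_congr fun u => by rw [if_neg (fun h => hκ h.2), zero_mul]).trans tsum_zero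

/-- [folklore] **THE IDENTITY TABLE LEG**: `vertexW (respStep M M) S κ′ u′ = S κ′ u′` (leaf-12's `respStep_self`: `respStep M M μ y κ u = [u = y ∧ κ = μ]`). -/
theorem vertexW_respStep_self (M : ℕ) [NeZero M] (S : Fin (d + 1) → (Fin (d + 1) → ℤ) → MKer (d + 1) (Fib d)) (κ' : Fin (d + 1)) (u' : Fin (d + 1) → ℤ) :
    vertexW (respStep (d := d) M M) S κ' u' = S κ' u' := by
  funext x z a b
  simp only [vertexW_apply, respStep_self]
  exact sum_tsum_ite_mul (fun κ u => S κ u x z a b) κ' u'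

/-- [folklore] **THE IDENTITY-LEG PUSH IS THE IDENTITY ON ff-VALUED ENTRIES**: `push₃ (respStep M M) (respStep M M) (respStep M M) S κ′ u′ = S κ′ u′` whenever `S κ′ u′` is
ff-valued (the three legs collapse by `respStep_self`; the ff corner is all of `S κ′ u′`). -/
theorem push₃_respStep_self (M : ℕ) [NeZero M] (S : Fin (d + 1) → (Fin (d + 1) → ℤ) → MKer (d + 1) (Fib d)) (κ' : Fin (d + 1)) (u' : Fin (d + 1) → ℤ)
    (hS : IsFF (S κ' u')) :
    push₃ (respStep (d := d) M M) (respStep (d := d) M M) (respStep (d := d) M M) S κ' u' = S κ' u' := by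
  funext x' z' a b
  rcases a with α | μ
  · rcases b with β | ν
    · rw [push₃_inl_inl, vertexW_respStep_self]
      simp only [respStep_self]
      rw [tsum_sum_mul_ite (fun z κ₂ => ∑' x : Fin (d + 1) → ℤ, ∑ κ₁ : Fin (d + 1),
        (if x = x' ∧ κ₁ = α then (1 : ℝ) else 0) * S κ' u' x z (Sum.inl κ₁) (Sum.inl κ₂)) z' β]
      exact tsum_sum_ite_mul (fun x κ₁ => S κ' u' x z' (Sum.inl κ₁) (Sum.inl β)) x' α
    · rw [push₃_inr_right, hS.2]
  · rw [push₃_inr_left, hS.1]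

/-! ## §2 The undressed one-step image of the V-source and the one-step telescope -/

variable {Lc : ℕ} [NeZero Lc]

/-- [folklore] The prefactor-free one-step image is ff-valued, dressed or not (`Push3.isFF_push₃` twice). -/
theorem isFF_twoPush (l₁ m₁ r₁ m₂ l₂ r₂ : Fin (d + 1) → (Fin (d + 1) → ℤ) → Fin (d + 1) → (Fin (d + 1) → ℤ) → ℝ)
    (S S' : Fin (d + 1) → (Fin (d + 1) → ℤ) → MKer (d + 1) (Fib d)) (κ : Fin (d + 1)) (u : Fin (d + 1) → ℤ) :
    IsFF ((fun κ u => -(push₃ l₁ m₁ r₁ S κ u + push₃ m₂ l₂ r₂ S' κ u)) κ u) :=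
  isFF_neg (isFF_add (isFF_push₃ l₁ m₁ r₁ S κ u) (isFF_push₃ m₂ l₂ r₂ S' κ u))

/-- NOT IN PRINT; OUR BOOKKEEPING.  **THE DRESSED ONE-STEP IMAGE WITH ITS PREFACTOR PULLED OUT**: `X_i = w • Y_i`,
`Y_i := −(push₃ (−R_i) (colM K̃_i Lc) R_i (reslot inl inr V) + push₃ (rowMM K̃_i Lc) R_i R_i (reslot inr inl V))` (PART 1b's `unitStepMap_v_eq_two_push₃`, restated pointwise). -/
theorem unitStepMap_v_apply {rr : Fin (d + 1) → ℕ} (hrr : rr ∈ box (d + 1) Lc) (cE cVH : ℝ) (i : ℕ) (κ' : Fin (d + 1)) (u' : Fin (d + 1) → ℤ) :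
    unitStepMap Lc (toSite rr) cE i (fun κ u => cVH • vhSAt (toSite rr) d Lc rfl κ u) κ' u'
      = (cE * (Lc : ℝ) ^ (2 * (d + 1))) •
        (fun κ u => -(push₃ (-respStepBm (toSite rr) Lc (Lc ^ i) (Lc ^ (i + 1))) (colM (KStepUnit (d := d) Lc i) Lc)
              (respStepBm (toSite rr) Lc (Lc ^ i) (Lc ^ (i + 1))) (reslot Sum.inl Sum.inr fun κ u => cVH • vhSAt (toSite rr) d Lc rfl κ u) κ u
          + push₃ (rowMM (KStepUnit (d := d) Lc i) Lc) (respStepBm (toSite rr) Lc (Lc ^ i) (Lc ^ (i + 1)))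
              (respStepBm (toSite rr) Lc (Lc ^ i) (Lc ^ (i + 1))) (reslot Sum.inr Sum.inl fun κ u => cVH • vhSAt (toSite rr) d Lc rfl κ u) κ u)) κ' u' := by
  rw [unitStepMap_v_eq_two_push₃ hrr cE cVH i]

/-- NOT IN PRINT; OUR BOOKKEEPING ((V-1) DESIGN, the owner's BORNV-PLAN-v0 §1).  **THE ONE-STEP TELESCOPE OF THE V-LINEAGE**: the dressed one-step image minus the
UNDRESSED one (`respStepBm ↦ respStep` in both mixed channels, multiplier legs untouched) is `w •` the NEGATIVE of the sum of the two channel differences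
`[push₃ (−R_i) (colM K̃_i) R_i S − push₃ (−R⁰_i) (colM K̃_i) R⁰_i S] + [push₃ (rowMM K̃_i) R_i R_i S′ − push₃ (rowMM K̃_i) R⁰_i R⁰_i S′]`, `S = reslot inl inr V`, `S′ = reslot inr inl V`
— each bracket is the input of leaf-02's `ContactBorderKernelCells.contact_border_fm_eq_cells` ∕ `_mf_eq_cells` (`lᴱ = −R_i`, `lᴮ = −R⁰_i`, resp. `rᴱ = R_i`, `rᴮ = R⁰_i`). -/
theorem unitStepMap_v_sub_undressed {rr : Fin (d + 1) → ℕ} (hrr : rr ∈ box (d + 1) Lc) (cE cVH : ℝ) (i : ℕ) (κ' : Fin (d + 1)) (u' : Fin (d + 1) → ℤ) :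
    unitStepMap Lc (toSite rr) cE i (fun κ u => cVH • vhSAt (toSite rr) d Lc rfl κ u) κ' u'
        - (cE * (Lc : ℝ) ^ (2 * (d + 1))) •
          (fun κ u => -(push₃ (-respStep (d := d) (Lc ^ i) (Lc ^ (i + 1))) (colM (KStepUnit (d := d) Lc i) Lc)
                (respStep (d := d) (Lc ^ i) (Lc ^ (i + 1))) (reslot Sum.inl Sum.inr fun κ u => cVH • vhSAt (toSite rr) d Lc rfl κ u) κ u
            + push₃ (rowMM (KStepUnit (d := d) Lc i) Lc) (respStep (d := d) (Lc ^ i) (Lc ^ (i + 1)))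
                (respStep (d := d) (Lc ^ i) (Lc ^ (i + 1))) (reslot Sum.inr Sum.inl fun κ u => cVH • vhSAt (toSite rr) d Lc rfl κ u) κ u)) κ' u'
      = -((cE * (Lc : ℝ) ^ (2 * (d + 1))) •
          ((push₃ (-respStepBm (toSite rr) Lc (Lc ^ i) (Lc ^ (i + 1))) (colM (KStepUnit (d := d) Lc i) Lc)
                (respStepBm (toSite rr) Lc (Lc ^ i) (Lc ^ (i + 1))) (reslot Sum.inl Sum.inr fun κ u => cVH • vhSAt (toSite rr) d Lc rfl κ u) κ' u'
              - push₃ (-respStep (d := d) (Lc ^ i) (Lc ^ (i + 1))) (colM (KStepUnit (d := d) Lc i) Lc)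
                (respStep (d := d) (Lc ^ i) (Lc ^ (i + 1))) (reslot Sum.inl Sum.inr fun κ u => cVH • vhSAt (toSite rr) d Lc rfl κ u) κ' u')
            + (push₃ (rowMM (KStepUnit (d := d) Lc i) Lc) (respStepBm (toSite rr) Lc (Lc ^ i) (Lc ^ (i + 1)))
                (respStepBm (toSite rr) Lc (Lc ^ i) (Lc ^ (i + 1))) (reslot Sum.inr Sum.inl fun κ u => cVH • vhSAt (toSite rr) d Lc rfl κ u) κ' u'
              - push₃ (rowMM (KStepUnit (d := d) Lc i) Lc) (respStep (d := d) (Lc ^ i) (Lc ^ (i + 1)))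
                (respStep (d := d) (Lc ^ i) (Lc ^ (i + 1))) (reslot Sum.inr Sum.inl fun κ u => cVH • vhSAt (toSite rr) d Lc rfl κ u) κ' u'))) := by
  rw [unitStepMap_v_apply hrr cE cVH i]
  simp only [smul_add, smul_neg, smul_sub]
  abel

/-! ## §3 Member `k`: source + undressed lineages + contact terms -/

/-- NOT IN PRINT; OUR BOOKKEEPING.  **THE DRESSED LINEAGE WITH `≥ 1` TRANSPORT STEP IS ONE WEIGHTED THREE-LEG PUSH FROM THE NEXT LEVEL**:
`D_{i,k} := transport unitStepMap (i+1) (n+1) X_i = w^{n+1} • push₃ T′ T′ T′ X_i`, `T′ = legChain (respStepBmSeq ρ Lc) (i+1) n` (leaf-03's `transport_unitStepMap_succ_eq_push₃` at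
base `i+1`: the one-step image is ff-valued and in the class, PART 1b §2). -/
theorem dressed_v_succ {rr : Fin (d + 1) → ℕ} (hrr : rr ∈ box (d + 1) Lc) (cE cVH : ℝ) (i n : ℕ) :
    transport (unitStepMap Lc (toSite rr) cE) (i + 1) (n + 1) (unitStepMap Lc (toSite rr) cE i (fun κ u => cVH • vhSAt (toSite rr) d Lc rfl κ u))
      = fun κ' u' => (cE * (Lc : ℝ) ^ (2 * (d + 1))) ^ (n + 1) •
          push₃ (legChain (respStepBmSeq (toSite rr) Lc) (i + 1) n) (legChain (respStepBmSeq (toSite rr) Lc) (i + 1) n)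
            (legChain (respStepBmSeq (toSite rr) Lc) (i + 1) n)
            (unitStepMap Lc (toSite rr) cE i (fun κ u => cVH • vhSAt (toSite rr) d Lc rfl κ u)) κ' u' :=
  transport_unitStepMap_succ_eq_push₃ hrr cE (i + 1) (fun κ u => isFF_unitStepMap_v hrr cE cVH i κ u) (isLoc_unitStepMap_v hrr cE cVH i) n

/-- [folklore] **THE TOP DRESSED LINEAGE IS THE ONE-STEP IMAGE ITSELF**: `D_{k−1,k} = transport unitStepMap k 0 X_{k−1} = X_{k−1}` (`transport_zero`). -/
theorem dressed_v_top (ρ : Fin (d + 1) → ℤ) (cE : ℝ) (i : ℕ) (X : Fin (d + 1) → (Fin (d + 1) → ℤ) → MKer (d + 1) (Fib d)) :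
    transport (unitStepMap Lc ρ cE) (i + 1) 0 X = X :=
  transport_zero _ _ _

/-- NOT IN PRINT; OUR BOOKKEEPING.  **THE TOP UNDRESSED LINEAGE IS THE UNDRESSED ONE-STEP IMAGE**: at `i = k−1` the outer legs `B_{k,k} = respStep (Lc^k) (Lc^k)` are the
identity legs, so `U_{k−1,k} = w • push₃ B_{k,k}³ Y⁰_{k−1} = w • Y⁰_{k−1} = X⁰_{k−1}` (§1 on the ff-valued `Y⁰`). -/
theorem undressed_v_top (ρ : Fin (d + 1) → ℤ) (cE cVH : ℝ) (i : ℕ) (κ' : Fin (d + 1)) (u' : Fin (d + 1) → ℤ) :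
    (cE * (Lc : ℝ) ^ (2 * (d + 1))) ^ (i + 1 - i) •
        push₃ (respStep (d := d) (Lc ^ (i + 1)) (Lc ^ (i + 1))) (respStep (d := d) (Lc ^ (i + 1)) (Lc ^ (i + 1)))
          (respStep (d := d) (Lc ^ (i + 1)) (Lc ^ (i + 1)))
          (fun κ u => -(push₃ (-respStep (d := d) (Lc ^ i) (Lc ^ (i + 1))) (colM (KStepUnit (d := d) Lc i) Lc)
                (respStep (d := d) (Lc ^ i) (Lc ^ (i + 1))) (reslot Sum.inl Sum.inr fun κ u => cVH • vhSAt ρ d Lc rfl κ u) κ u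
            + push₃ (rowMM (KStepUnit (d := d) Lc i) Lc) (respStep (d := d) (Lc ^ i) (Lc ^ (i + 1)))
                (respStep (d := d) (Lc ^ i) (Lc ^ (i + 1))) (reslot Sum.inr Sum.inl fun κ u => cVH • vhSAt ρ d Lc rfl κ u) κ u)) κ' u'
      = (cE * (Lc : ℝ) ^ (2 * (d + 1))) •
          (fun κ u => -(push₃ (-respStep (d := d) (Lc ^ i) (Lc ^ (i + 1))) (colM (KStepUnit (d := d) Lc i) Lc)
                (respStep (d := d) (Lc ^ i) (Lc ^ (i + 1))) (reslot Sum.inl Sum.inr fun κ u => cVH • vhSAt ρ d Lc rfl κ u) κ u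
            + push₃ (rowMM (KStepUnit (d := d) Lc i) Lc) (respStep (d := d) (Lc ^ i) (Lc ^ (i + 1)))
                (respStep (d := d) (Lc ^ i) (Lc ^ (i + 1))) (reslot Sum.inr Sum.inl fun κ u => cVH • vhSAt ρ d Lc rfl κ u) κ u)) κ' u' := by
  rw [show i + 1 - i = 1 by omega, pow_one, push₃_respStep_self _ _ κ' u' (isFF_twoPush _ _ _ _ _ _ _ _ κ' u')]

/-- NOT IN PRINT; OUR BOOKKEEPING ((V-1), the owner's BORNV-PLAN-v0 §1; [folklore]).  **THE V-BORN REMAINDER IN UNITS = SOURCE + UNDRESSED LINEAGES + CONTACT TERMS**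
(in-block root): with `X_i := unitStepMap Lc ρ cE i V` (PART 1b §2), the DRESSED lineage `D_{i,k} := transport unitStepMap (i+1) (k−1−i) X_i` and the UNDRESSED lineage
`U_{i,k} := w^{k−i} • push₃ B_{i+1,k} B_{i+1,k} B_{i+1,k} (−(push₃ (−R⁰_i) (colM K̃_i Lc) R⁰_i (reslot inl inr V) + push₃ (rowMM K̃_i Lc) R⁰_i R⁰_i (reslot inr inl V)))`,
`unitS_k (bornSecAt Lc ρ cE cVH 0 k) = V + Σ_{i<k} U_{i,k} + Σ_{i<k} (D_{i,k} − U_{i,k})`.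
The middle sum is the UNDRESSED V row ((V-U): road S3's rooted V rows, to be read in this currency by the owner's `BornBorderLift`); each summand of the last sum is the
contact term of one lineage ((V-C)): at the top the one-step telescope of §2, below it the three-slot telescope `T′ − B_{i+1,k}` composed with it. -/
theorem unitS_bornV_eq_source_add_undressed_add_contact {rr : Fin (d + 1) → ℕ} (hrr : rr ∈ box (d + 1) Lc) (cE cVH : ℝ) (k : ℕ) :
    unitS (sfStep Lc k) (smStep d Lc k) (bornSecAt Lc (toSite rr) cE cVH 0 k)
      = (fun κ u => cVH • vhSAt (toSite rr) d Lc rfl κ u)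
        + ∑ i ∈ Finset.range k, (fun κ' u' => (cE * (Lc : ℝ) ^ (2 * (d + 1))) ^ (k - i) •
            push₃ (respStep (d := d) (Lc ^ (i + 1)) (Lc ^ k)) (respStep (d := d) (Lc ^ (i + 1)) (Lc ^ k)) (respStep (d := d) (Lc ^ (i + 1)) (Lc ^ k))
              (fun κ u => -(push₃ (-respStep (d := d) (Lc ^ i) (Lc ^ (i + 1))) (colM (KStepUnit (d := d) Lc i) Lc)
                    (respStep (d := d) (Lc ^ i) (Lc ^ (i + 1))) (reslot Sum.inl Sum.inr fun κ u => cVH • vhSAt (toSite rr) d Lc rfl κ u) κ u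
                + push₃ (rowMM (KStepUnit (d := d) Lc i) Lc) (respStep (d := d) (Lc ^ i) (Lc ^ (i + 1)))
                    (respStep (d := d) (Lc ^ i) (Lc ^ (i + 1))) (reslot Sum.inr Sum.inl fun κ u => cVH • vhSAt (toSite rr) d Lc rfl κ u) κ u)) κ' u')
        + ∑ i ∈ Finset.range k, (transport (unitStepMap Lc (toSite rr) cE) (i + 1) (k - 1 - i)
              (unitStepMap Lc (toSite rr) cE i (fun κ u => cVH • vhSAt (toSite rr) d Lc rfl κ u))
            - fun κ' u' => (cE * (Lc : ℝ) ^ (2 * (d + 1))) ^ (k - i) •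
              push₃ (respStep (d := d) (Lc ^ (i + 1)) (Lc ^ k)) (respStep (d := d) (Lc ^ (i + 1)) (Lc ^ k)) (respStep (d := d) (Lc ^ (i + 1)) (Lc ^ k))
                (fun κ u => -(push₃ (-respStep (d := d) (Lc ^ i) (Lc ^ (i + 1))) (colM (KStepUnit (d := d) Lc i) Lc)
                      (respStep (d := d) (Lc ^ i) (Lc ^ (i + 1))) (reslot Sum.inl Sum.inr fun κ u => cVH • vhSAt (toSite rr) d Lc rfl κ u) κ u
                  + push₃ (rowMM (KStepUnit (d := d) Lc i) Lc) (respStep (d := d) (Lc ^ i) (Lc ^ (i + 1)))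
                      (respStep (d := d) (Lc ^ i) (Lc ^ (i + 1))) (reslot Sum.inr Sum.inl fun κ u => cVH • vhSAt (toSite rr) d Lc rfl κ u) κ u)) κ' u') := by
  rw [unitS_bornV_eq_sum hrr cE cVH k, add_assoc, ← Finset.sum_add_distrib]
  congr 1
  refine Finset.sum_congr rfl fun i _ => ?_
  abel

/-! ## §4 The V-born target as a socket: `hB(cVH, 0) ⟸ hUv ∧ hCv` (the source letter discharged) -/

section Letters

/-- NOT IN PRINT; OUR BOOKKEEPING ((V-1) socket, V sector).  **THE V-BORN ROW FROM TWO LETTERS**: a uniform `LocStencil` letter for the UNDRESSED V lineages summed over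
the birth levels (`hUv` — (V-U), road S3's rooted V rows read in this currency) and one for the CONTACT terms summed the same way (`hCv` — (V-C)), both uniform in the
in-block root and the level, give the letter `hB(cVH, 0)` of `BornLambdaLineage.exists_hB_of_sectors`; the born V-table's own locality is PART 1b's `exists_hX_v` at the
common rate (constants added; §3's identity). -/
theorem exists_hBv_of_letters (cE cVH : ℝ)
    (hU : ∃ C δ : ℝ, 0 < δ ∧ ∀ (rr : Fin (d + 1) → ℕ), rr ∈ box (d + 1) Lc → ∀ k : ℕ,
      LocStencil (∑ i ∈ Finset.range k, fun κ' u' => (cE * (Lc : ℝ) ^ (2 * (d + 1))) ^ (k - i) •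
        push₃ (respStep (d := d) (Lc ^ (i + 1)) (Lc ^ k)) (respStep (d := d) (Lc ^ (i + 1)) (Lc ^ k)) (respStep (d := d) (Lc ^ (i + 1)) (Lc ^ k))
          (fun κ u => -(push₃ (-respStep (d := d) (Lc ^ i) (Lc ^ (i + 1))) (colM (KStepUnit (d := d) Lc i) Lc)
                (respStep (d := d) (Lc ^ i) (Lc ^ (i + 1))) (reslot Sum.inl Sum.inr fun κ u => cVH • vhSAt (toSite rr) d Lc rfl κ u) κ u
            + push₃ (rowMM (KStepUnit (d := d) Lc i) Lc) (respStep (d := d) (Lc ^ i) (Lc ^ (i + 1)))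
                (respStep (d := d) (Lc ^ i) (Lc ^ (i + 1))) (reslot Sum.inr Sum.inl fun κ u => cVH • vhSAt (toSite rr) d Lc rfl κ u) κ u)) κ' u') C δ)
    (hC : ∃ C δ : ℝ, 0 < δ ∧ ∀ (rr : Fin (d + 1) → ℕ), rr ∈ box (d + 1) Lc → ∀ k : ℕ,
      LocStencil (∑ i ∈ Finset.range k, (transport (unitStepMap Lc (toSite rr) cE) (i + 1) (k - 1 - i)
          (unitStepMap Lc (toSite rr) cE i (fun κ u => cVH • vhSAt (toSite rr) d Lc rfl κ u))
        - fun κ' u' => (cE * (Lc : ℝ) ^ (2 * (d + 1))) ^ (k - i) •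
          push₃ (respStep (d := d) (Lc ^ (i + 1)) (Lc ^ k)) (respStep (d := d) (Lc ^ (i + 1)) (Lc ^ k)) (respStep (d := d) (Lc ^ (i + 1)) (Lc ^ k))
            (fun κ u => -(push₃ (-respStep (d := d) (Lc ^ i) (Lc ^ (i + 1))) (colM (KStepUnit (d := d) Lc i) Lc)
                  (respStep (d := d) (Lc ^ i) (Lc ^ (i + 1))) (reslot Sum.inl Sum.inr fun κ u => cVH • vhSAt (toSite rr) d Lc rfl κ u) κ u
              + push₃ (rowMM (KStepUnit (d := d) Lc i) Lc) (respStep (d := d) (Lc ^ i) (Lc ^ (i + 1)))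
                  (respStep (d := d) (Lc ^ i) (Lc ^ (i + 1))) (reslot Sum.inr Sum.inl fun κ u => cVH • vhSAt (toSite rr) d Lc rfl κ u) κ u)) κ' u')) C δ) :
    ∃ C δ : ℝ, 0 < δ ∧ ∀ (rr : Fin (d + 1) → ℕ), rr ∈ box (d + 1) Lc →
      ∀ k : ℕ, LocStencil (unitS (sfStep Lc k) (smStep d Lc k) (bornSecAt Lc (toSite rr) cE cVH 0 k)) C δ := by
  obtain ⟨CU, δU, hδU, hU⟩ := hU
  obtain ⟨CC, δC, hδC, hC⟩ := hC
  have hδ : 0 < min δU δC := lt_min hδU hδC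
  refine ⟨|cVH| * (3 * (ell (d + 1) Lc : ℝ) ^ 2 * Real.exp (4 * ((d : ℝ) + 1) * Lc * min δU δC)) + CU + CC, min δU δC, hδ, fun rr hrr k => ?_⟩
  have hCU : 0 ≤ CU := ((hU rr hrr k) 0 0).nonneg (Sum.inl 0)
  have hCC : 0 ≤ CC := ((hC rr hrr k) 0 0).nonneg (Sum.inl 0)
  have h1 := exists_hX_v (d := d) (one_le_of_neZero Lc) cVH hδ.le rr hrr 0
  rw [BornBorderLineage.unitS_freshAt_v] at h1
  rw [unitS_bornV_eq_source_add_undressed_add_contact hrr cE cVH k]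
  have h2 := locStencil_mono (hU rr hrr k) hCU (min_le_left δU δC)
  have h3 := locStencil_mono (hC rr hrr k) hCC (min_le_right δU δC)
  exact locStencil_add (locStencil_add h1 h2) h3

/-- NOT IN PRINT; OUR BOOKKEEPING.  **THE UNDRESSED-LINEAGE LETTER `hUv` FROM A PER-LINEAGE GEOMETRIC LETTER** ((V-U)'s expected shape — road S3's rooted V rows are
geometric in the depth): per-lineage constants `C·θ^{k−i}` at one rate (`0 ≤ C`, `0 ≤ θ < 1`) ⇒ the sum over `i < k` with the `k`-free constant `C·θ∕(1−θ)`. -/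
theorem exists_hUv_of_geometric (cE cVH : ℝ)
    (hUg : ∃ C θ δ : ℝ, 0 ≤ C ∧ 0 ≤ θ ∧ θ < 1 ∧ 0 < δ ∧ ∀ (rr : Fin (d + 1) → ℕ), rr ∈ box (d + 1) Lc → ∀ k i : ℕ, i < k →
      LocStencil (fun κ' u' => (cE * (Lc : ℝ) ^ (2 * (d + 1))) ^ (k - i) •
        push₃ (respStep (d := d) (Lc ^ (i + 1)) (Lc ^ k)) (respStep (d := d) (Lc ^ (i + 1)) (Lc ^ k)) (respStep (d := d) (Lc ^ (i + 1)) (Lc ^ k))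
          (fun κ u => -(push₃ (-respStep (d := d) (Lc ^ i) (Lc ^ (i + 1))) (colM (KStepUnit (d := d) Lc i) Lc)
                (respStep (d := d) (Lc ^ i) (Lc ^ (i + 1))) (reslot Sum.inl Sum.inr fun κ u => cVH • vhSAt (toSite rr) d Lc rfl κ u) κ u
            + push₃ (rowMM (KStepUnit (d := d) Lc i) Lc) (respStep (d := d) (Lc ^ i) (Lc ^ (i + 1)))
                (respStep (d := d) (Lc ^ i) (Lc ^ (i + 1))) (reslot Sum.inr Sum.inl fun κ u => cVH • vhSAt (toSite rr) d Lc rfl κ u) κ u)) κ' u')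
        (C * θ ^ (k - i)) δ) :
    ∃ C δ : ℝ, 0 < δ ∧ ∀ (rr : Fin (d + 1) → ℕ), rr ∈ box (d + 1) Lc → ∀ k : ℕ,
      LocStencil (∑ i ∈ Finset.range k, fun κ' u' => (cE * (Lc : ℝ) ^ (2 * (d + 1))) ^ (k - i) •
        push₃ (respStep (d := d) (Lc ^ (i + 1)) (Lc ^ k)) (respStep (d := d) (Lc ^ (i + 1)) (Lc ^ k)) (respStep (d := d) (Lc ^ (i + 1)) (Lc ^ k))
          (fun κ u => -(push₃ (-respStep (d := d) (Lc ^ i) (Lc ^ (i + 1))) (colM (KStepUnit (d := d) Lc i) Lc)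
                (respStep (d := d) (Lc ^ i) (Lc ^ (i + 1))) (reslot Sum.inl Sum.inr fun κ u => cVH • vhSAt (toSite rr) d Lc rfl κ u) κ u
            + push₃ (rowMM (KStepUnit (d := d) Lc i) Lc) (respStep (d := d) (Lc ^ i) (Lc ^ (i + 1)))
                (respStep (d := d) (Lc ^ i) (Lc ^ (i + 1))) (reslot Sum.inr Sum.inl fun κ u => cVH • vhSAt (toSite rr) d Lc rfl κ u) κ u)) κ' u') C δ := by
  obtain ⟨C, θ, δ, hC0, hθ0, hθ1, hδ, h⟩ := hUg
  exact ⟨C * (θ / (1 - θ)), δ, hδ, fun rr hrr k => locStencil_sum_of_geometric hC0 hθ0 hθ1 k fun i hi => h rr hrr k i hi⟩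

/-- NOT IN PRINT; OUR BOOKKEEPING.  **THE CONTACT LETTER `hCv` FROM A PER-LINEAGE GEOMETRIC LETTER** ((V-C)'s expected shape without logs): per-lineage constants
`C·θ^{k−i}` ⇒ the sum with `C·θ∕(1−θ)`. -/
theorem exists_hCv_of_geometric (cE cVH : ℝ)
    (hCg : ∃ C θ δ : ℝ, 0 ≤ C ∧ 0 ≤ θ ∧ θ < 1 ∧ 0 < δ ∧ ∀ (rr : Fin (d + 1) → ℕ), rr ∈ box (d + 1) Lc → ∀ k i : ℕ, i < k →
      LocStencil (transport (unitStepMap Lc (toSite rr) cE) (i + 1) (k - 1 - i)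
          (unitStepMap Lc (toSite rr) cE i (fun κ u => cVH • vhSAt (toSite rr) d Lc rfl κ u))
        - fun κ' u' => (cE * (Lc : ℝ) ^ (2 * (d + 1))) ^ (k - i) •
          push₃ (respStep (d := d) (Lc ^ (i + 1)) (Lc ^ k)) (respStep (d := d) (Lc ^ (i + 1)) (Lc ^ k)) (respStep (d := d) (Lc ^ (i + 1)) (Lc ^ k))
            (fun κ u => -(push₃ (-respStep (d := d) (Lc ^ i) (Lc ^ (i + 1))) (colM (KStepUnit (d := d) Lc i) Lc)
                  (respStep (d := d) (Lc ^ i) (Lc ^ (i + 1))) (reslot Sum.inl Sum.inr fun κ u => cVH • vhSAt (toSite rr) d Lc rfl κ u) κ u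
              + push₃ (rowMM (KStepUnit (d := d) Lc i) Lc) (respStep (d := d) (Lc ^ i) (Lc ^ (i + 1)))
                  (respStep (d := d) (Lc ^ i) (Lc ^ (i + 1))) (reslot Sum.inr Sum.inl fun κ u => cVH • vhSAt (toSite rr) d Lc rfl κ u) κ u)) κ' u')
        (C * θ ^ (k - i)) δ) :
    ∃ C δ : ℝ, 0 < δ ∧ ∀ (rr : Fin (d + 1) → ℕ), rr ∈ box (d + 1) Lc → ∀ k : ℕ,
      LocStencil (∑ i ∈ Finset.range k, (transport (unitStepMap Lc (toSite rr) cE) (i + 1) (k - 1 - i)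
          (unitStepMap Lc (toSite rr) cE i (fun κ u => cVH • vhSAt (toSite rr) d Lc rfl κ u))
        - fun κ' u' => (cE * (Lc : ℝ) ^ (2 * (d + 1))) ^ (k - i) •
          push₃ (respStep (d := d) (Lc ^ (i + 1)) (Lc ^ k)) (respStep (d := d) (Lc ^ (i + 1)) (Lc ^ k)) (respStep (d := d) (Lc ^ (i + 1)) (Lc ^ k))
            (fun κ u => -(push₃ (-respStep (d := d) (Lc ^ i) (Lc ^ (i + 1))) (colM (KStepUnit (d := d) Lc i) Lc)
                  (respStep (d := d) (Lc ^ i) (Lc ^ (i + 1))) (reslot Sum.inl Sum.inr fun κ u => cVH • vhSAt (toSite rr) d Lc rfl κ u) κ u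
              + push₃ (rowMM (KStepUnit (d := d) Lc i) Lc) (respStep (d := d) (Lc ^ i) (Lc ^ (i + 1)))
                  (respStep (d := d) (Lc ^ i) (Lc ^ (i + 1))) (reslot Sum.inr Sum.inl fun κ u => cVH • vhSAt (toSite rr) d Lc rfl κ u) κ u)) κ' u')) C δ := by
  obtain ⟨C, θ, δ, hC0, hθ0, hθ1, hδ, h⟩ := hCg
  exact ⟨C * (θ / (1 - θ)), δ, hδ, fun rr hrr k => locStencil_sum_of_geometric hC0 hθ0 hθ1 k fun i hi => h rr hrr k i hi⟩

/-- NOT IN PRINT; OUR BOOKKEEPING.  **THE CONTACT LETTER `hCv` FROM A PER-LINEAGE LETTER WITH LOGS** ((V-C)'s expected shape — one log per face sum, leaf-03's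
(C5)): per-lineage constants `C·(k−i)^p·θ^{k−i}` ⇒ the sum with `C·p!·θ∕(1−θ)^{p+1}` (leaf-03's `locStencil_sum_of_polyGeometric`). -/
theorem exists_hCv_of_polyGeometric (cE cVH : ℝ) (p : ℕ)
    (hCg : ∃ C θ δ : ℝ, 0 ≤ C ∧ 0 ≤ θ ∧ θ < 1 ∧ 0 < δ ∧ ∀ (rr : Fin (d + 1) → ℕ), rr ∈ box (d + 1) Lc → ∀ k i : ℕ, i < k →
      LocStencil (transport (unitStepMap Lc (toSite rr) cE) (i + 1) (k - 1 - i)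
          (unitStepMap Lc (toSite rr) cE i (fun κ u => cVH • vhSAt (toSite rr) d Lc rfl κ u))
        - fun κ' u' => (cE * (Lc : ℝ) ^ (2 * (d + 1))) ^ (k - i) •
          push₃ (respStep (d := d) (Lc ^ (i + 1)) (Lc ^ k)) (respStep (d := d) (Lc ^ (i + 1)) (Lc ^ k)) (respStep (d := d) (Lc ^ (i + 1)) (Lc ^ k))
            (fun κ u => -(push₃ (-respStep (d := d) (Lc ^ i) (Lc ^ (i + 1))) (colM (KStepUnit (d := d) Lc i) Lc)
                  (respStep (d := d) (Lc ^ i) (Lc ^ (i + 1))) (reslot Sum.inl Sum.inr fun κ u => cVH • vhSAt (toSite rr) d Lc rfl κ u) κ u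
              + push₃ (rowMM (KStepUnit (d := d) Lc i) Lc) (respStep (d := d) (Lc ^ i) (Lc ^ (i + 1)))
                  (respStep (d := d) (Lc ^ i) (Lc ^ (i + 1))) (reslot Sum.inr Sum.inl fun κ u => cVH • vhSAt (toSite rr) d Lc rfl κ u) κ u)) κ' u')
        (C * (((k - i : ℕ) : ℝ) ^ p * θ ^ (k - i))) δ) :
    ∃ C δ : ℝ, 0 < δ ∧ ∀ (rr : Fin (d + 1) → ℕ), rr ∈ box (d + 1) Lc → ∀ k : ℕ,
      LocStencil (∑ i ∈ Finset.range k, (transport (unitStepMap Lc (toSite rr) cE) (i + 1) (k - 1 - i)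
          (unitStepMap Lc (toSite rr) cE i (fun κ u => cVH • vhSAt (toSite rr) d Lc rfl κ u))
        - fun κ' u' => (cE * (Lc : ℝ) ^ (2 * (d + 1))) ^ (k - i) •
          push₃ (respStep (d := d) (Lc ^ (i + 1)) (Lc ^ k)) (respStep (d := d) (Lc ^ (i + 1)) (Lc ^ k)) (respStep (d := d) (Lc ^ (i + 1)) (Lc ^ k))
            (fun κ u => -(push₃ (-respStep (d := d) (Lc ^ i) (Lc ^ (i + 1))) (colM (KStepUnit (d := d) Lc i) Lc)
                  (respStep (d := d) (Lc ^ i) (Lc ^ (i + 1))) (reslot Sum.inl Sum.inr fun κ u => cVH • vhSAt (toSite rr) d Lc rfl κ u) κ u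
              + push₃ (rowMM (KStepUnit (d := d) Lc i) Lc) (respStep (d := d) (Lc ^ i) (Lc ^ (i + 1)))
                  (respStep (d := d) (Lc ^ i) (Lc ^ (i + 1))) (reslot Sum.inr Sum.inl fun κ u => cVH • vhSAt (toSite rr) d Lc rfl κ u) κ u)) κ' u')) C δ := by
  obtain ⟨C, θ, δ, hC0, hθ0, hθ1, hδ, h⟩ := hCg
  exact ⟨C * ((p.factorial : ℝ) * θ / (1 - θ) ^ (p + 1)), δ, hδ, fun rr hrr k =>
    locStencil_sum_of_polyGeometric p hC0 hθ0 hθ1 k fun i hi => h rr hrr k i hi⟩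

/-- NOT IN PRINT; OUR BOOKKEEPING ((V-1) END SHAPE, generic `d`).  **THE V-BORN ROW FROM TWO PER-LINEAGE GEOMETRIC LETTERS** — one for every weighted UNDRESSED V lineage
((V-U)) and one for every CONTACT term ((V-C)), constants `C·θ^{k−i}`, `θ < 1`, one rate, uniform in the in-block root — give `hB(cVH, 0)`.  This is the statement the
owner's BORNV-PLAN-v0 has to prove, lineage by lineage; nothing of it is claimed here. -/
theorem exists_hBv_of_geometric (cE cVH : ℝ)
    (hUg : ∃ C θ δ : ℝ, 0 ≤ C ∧ 0 ≤ θ ∧ θ < 1 ∧ 0 < δ ∧ ∀ (rr : Fin (d + 1) → ℕ), rr ∈ box (d + 1) Lc → ∀ k i : ℕ, i < k →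
      LocStencil (fun κ' u' => (cE * (Lc : ℝ) ^ (2 * (d + 1))) ^ (k - i) •
        push₃ (respStep (d := d) (Lc ^ (i + 1)) (Lc ^ k)) (respStep (d := d) (Lc ^ (i + 1)) (Lc ^ k)) (respStep (d := d) (Lc ^ (i + 1)) (Lc ^ k))
          (fun κ u => -(push₃ (-respStep (d := d) (Lc ^ i) (Lc ^ (i + 1))) (colM (KStepUnit (d := d) Lc i) Lc)
                (respStep (d := d) (Lc ^ i) (Lc ^ (i + 1))) (reslot Sum.inl Sum.inr fun κ u => cVH • vhSAt (toSite rr) d Lc rfl κ u) κ u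
            + push₃ (rowMM (KStepUnit (d := d) Lc i) Lc) (respStep (d := d) (Lc ^ i) (Lc ^ (i + 1)))
                (respStep (d := d) (Lc ^ i) (Lc ^ (i + 1))) (reslot Sum.inr Sum.inl fun κ u => cVH • vhSAt (toSite rr) d Lc rfl κ u) κ u)) κ' u')
        (C * θ ^ (k - i)) δ)
    (hCg : ∃ C θ δ : ℝ, 0 ≤ C ∧ 0 ≤ θ ∧ θ < 1 ∧ 0 < δ ∧ ∀ (rr : Fin (d + 1) → ℕ), rr ∈ box (d + 1) Lc → ∀ k i : ℕ, i < k →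
      LocStencil (transport (unitStepMap Lc (toSite rr) cE) (i + 1) (k - 1 - i)
          (unitStepMap Lc (toSite rr) cE i (fun κ u => cVH • vhSAt (toSite rr) d Lc rfl κ u))
        - fun κ' u' => (cE * (Lc : ℝ) ^ (2 * (d + 1))) ^ (k - i) •
          push₃ (respStep (d := d) (Lc ^ (i + 1)) (Lc ^ k)) (respStep (d := d) (Lc ^ (i + 1)) (Lc ^ k)) (respStep (d := d) (Lc ^ (i + 1)) (Lc ^ k))
            (fun κ u => -(push₃ (-respStep (d := d) (Lc ^ i) (Lc ^ (i + 1))) (colM (KStepUnit (d := d) Lc i) Lc)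
                  (respStep (d := d) (Lc ^ i) (Lc ^ (i + 1))) (reslot Sum.inl Sum.inr fun κ u => cVH • vhSAt (toSite rr) d Lc rfl κ u) κ u
              + push₃ (rowMM (KStepUnit (d := d) Lc i) Lc) (respStep (d := d) (Lc ^ i) (Lc ^ (i + 1)))
                  (respStep (d := d) (Lc ^ i) (Lc ^ (i + 1))) (reslot Sum.inr Sum.inl fun κ u => cVH • vhSAt (toSite rr) d Lc rfl κ u) κ u)) κ' u')
        (C * θ ^ (k - i)) δ) :
    ∃ C δ : ℝ, 0 < δ ∧ ∀ (rr : Fin (d + 1) → ℕ), rr ∈ box (d + 1) Lc →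
      ∀ k : ℕ, LocStencil (unitS (sfStep Lc k) (smStep d Lc k) (bornSecAt Lc (toSite rr) cE cVH 0 k)) C δ :=
  exists_hBv_of_letters cE cVH (exists_hUv_of_geometric cE cVH hUg) (exists_hCv_of_geometric cE cVH hCg)

/-- NOT IN PRINT; OUR BOOKKEEPING ((V-1) END SHAPE with logs in the contact letter, generic `d`).  **THE V-BORN ROW FROM A GEOMETRIC UNDRESSED LETTER AND A
POLY-GEOMETRIC CONTACT LETTER** (`C·(k−i)^p·θ^{k−i}` — the one log of the (C5) face sum is `p = 1`). -/
theorem exists_hBv_of_geometric_poly (cE cVH : ℝ) (p : ℕ)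
    (hUg : ∃ C θ δ : ℝ, 0 ≤ C ∧ 0 ≤ θ ∧ θ < 1 ∧ 0 < δ ∧ ∀ (rr : Fin (d + 1) → ℕ), rr ∈ box (d + 1) Lc → ∀ k i : ℕ, i < k →
      LocStencil (fun κ' u' => (cE * (Lc : ℝ) ^ (2 * (d + 1))) ^ (k - i) •
        push₃ (respStep (d := d) (Lc ^ (i + 1)) (Lc ^ k)) (respStep (d := d) (Lc ^ (i + 1)) (Lc ^ k)) (respStep (d := d) (Lc ^ (i + 1)) (Lc ^ k))
          (fun κ u => -(push₃ (-respStep (d := d) (Lc ^ i) (Lc ^ (i + 1))) (colM (KStepUnit (d := d) Lc i) Lc)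
                (respStep (d := d) (Lc ^ i) (Lc ^ (i + 1))) (reslot Sum.inl Sum.inr fun κ u => cVH • vhSAt (toSite rr) d Lc rfl κ u) κ u
            + push₃ (rowMM (KStepUnit (d := d) Lc i) Lc) (respStep (d := d) (Lc ^ i) (Lc ^ (i + 1)))
                (respStep (d := d) (Lc ^ i) (Lc ^ (i + 1))) (reslot Sum.inr Sum.inl fun κ u => cVH • vhSAt (toSite rr) d Lc rfl κ u) κ u)) κ' u')
        (C * θ ^ (k - i)) δ)
    (hCg : ∃ C θ δ : ℝ, 0 ≤ C ∧ 0 ≤ θ ∧ θ < 1 ∧ 0 < δ ∧ ∀ (rr : Fin (d + 1) → ℕ), rr ∈ box (d + 1) Lc → ∀ k i : ℕ, i < k →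
      LocStencil (transport (unitStepMap Lc (toSite rr) cE) (i + 1) (k - 1 - i)
          (unitStepMap Lc (toSite rr) cE i (fun κ u => cVH • vhSAt (toSite rr) d Lc rfl κ u))
        - fun κ' u' => (cE * (Lc : ℝ) ^ (2 * (d + 1))) ^ (k - i) •
          push₃ (respStep (d := d) (Lc ^ (i + 1)) (Lc ^ k)) (respStep (d := d) (Lc ^ (i + 1)) (Lc ^ k)) (respStep (d := d) (Lc ^ (i + 1)) (Lc ^ k))
            (fun κ u => -(push₃ (-respStep (d := d) (Lc ^ i) (Lc ^ (i + 1))) (colM (KStepUnit (d := d) Lc i) Lc)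
                  (respStep (d := d) (Lc ^ i) (Lc ^ (i + 1))) (reslot Sum.inl Sum.inr fun κ u => cVH • vhSAt (toSite rr) d Lc rfl κ u) κ u
              + push₃ (rowMM (KStepUnit (d := d) Lc i) Lc) (respStep (d := d) (Lc ^ i) (Lc ^ (i + 1)))
                  (respStep (d := d) (Lc ^ i) (Lc ^ (i + 1))) (reslot Sum.inr Sum.inl fun κ u => cVH • vhSAt (toSite rr) d Lc rfl κ u) κ u)) κ' u')
        (C * (((k - i : ℕ) : ℝ) ^ p * θ ^ (k - i))) δ) :
    ∃ C δ : ℝ, 0 < δ ∧ ∀ (rr : Fin (d + 1) → ℕ), rr ∈ box (d + 1) Lc →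
      ∀ k : ℕ, LocStencil (unitS (sfStep Lc k) (smStep d Lc k) (bornSecAt Lc (toSite rr) cE cVH 0 k)) C δ :=
  exists_hBv_of_letters cE cVH (exists_hUv_of_geometric cE cVH hUg) (exists_hCv_of_polyGeometric cE cVH p hCg)

end Letters

end Summit.QuantumFields.BalabanUV.Beta.GAN24.BornBorderLetters

end
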